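import Literature.Analysis.FluidPDE.OseenKernelComplex
import Literature.Analysis.FluidPDE.NewtonGradientPotential
import Literature.Analysis.FluidPDE.NewtonPotentialRepresentation
import Literature.Analysis.FluidPDE.NSLocalAnalyticityRadiusTube
import HarnessLib

/-!
# The complexified gradient of the Newtonian kernel and the holomorphic continuation of
# gradient potentials off the support of their density

Analysis/FluidPDE definitions file (two definitions, everything else proved), module H of the
proof of the named fact
`Literature.Analysis.FluidPDE.bradshawGrujicKukavica2015_local_analyticity_radius`
(`NSLocalAnalyticityRadius.lean`; Bradshaw–Grujić–Kukavica, J. Differential Equations 259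
(2015), Thm. 2.3; survey: Cambridge LMS Lecture Notes 430 (2016), Thm. 2.3.1). In the tree's
proof of that fact (recorded in `NSLocalAnalyticityRadiusUnitScale.lean`) the localised velocity
`v = χu` is split as `v = ℙv + ∇(Γ ⋆ div v)`, and the gradient part
`b = ∇(Γ ⋆ g)`, `g = ∇χ · u` (a gradient potential of a density supported in the cut-off
annulus), has to be continued holomorphically in the space variable to complex points
`x + iy` lying over the inner ball, far from the support of `g`, with explicit bounds. This is
elementary: the kernel `∇Γ(z) = z/(4π|z|³)` continues to
`∇Γ_ℂ(ξ) = ξ/(4π (ξ·ξ)^{3/2})` (principal power; `ξ·ξ` the bilinear square `cdot ξ ξ` of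
`OseenKernelComplex.lean`), holomorphic where `Re(ξ·ξ) > 0`, in particular at
`ξ = cx r + i cx η` with `‖η‖ ≤ ‖r‖/2` (`Re(ξ·ξ) = ‖r‖² - ‖η‖² ≥ 3‖r‖²/4`), where
`‖∇Γ_ℂ(ξ)‖ ≤ ‖r‖⁻²`. This file proves:

* `newtonGradKernelC ξ = ((4π)⁻¹ (ξ·ξ)^{-3/2}) • ξ`; real restriction
  `newtonGradKernelC (cx z) = cx ((4π‖z‖³)⁻¹ • z) = ∑ⱼ ∂ⱼΓ(z) • cx eⱼ`
  (`newtonGradKernelC_complexify`, `newtonGradKernelC_complexify_eq_sum`); holomorphy in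
  composable form (`DifferentiableAt.newtonGradKernelC`); the sector bound
  `‖∇Γ_ℂ(cx r + i cx η)‖ ≤ ‖r‖⁻²` for `‖η‖ ≤ ‖r‖/2` (`norm_newtonGradKernelC_le`);
* `newtonGradPotentialC g ζ = ∫ g(w) ∇Γ_ℂ(ζ - cx w) dw`, the continued gradient potential of a
  real density `g`: for continuous compactly supported `g` it is **holomorphic on every open set
  of points `cx x + i cx y` with `‖y‖ ≤ D/2` and `dist(x, supp g) ≥ D`**
  (`differentiableOn_newtonGradPotentialC`, holomorphy of dominated parameter integrals,
  `Literature.Analysis.Complex.differentiableOn_integral_of_dominated`), bounded there by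
  `D⁻² ‖g‖_{L¹}` (`norm_newtonGradPotentialC_le`), and **its restriction to real points is the
  gradient potential** `∑ⱼ T_{eⱼ} g (x) eⱼ` of `NewtonGradientPotential.lean`
  (`newtonGradPotentialC_complexify`; `T_a g (x) = ∫ ∂_aΓ(x - w) g(w) dw`).

## Mathlib / tree search

Tree: `cdot`, `cdot_complexify_self`, `DifferentiableAt.cdot`, `complexify_smul`
(`OseenKernelComplex.lean`); `re_cdot_imShift`-type computations are redone here for the sign
convention `cx r + i cx η`; `newtonGradPotential`, `fderiv_newtonKernel_apply`,
`fderiv_newtonKernel_zero`, `integrable_fderiv_newtonKernel_smul` (`NewtonGradientPotential`,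
`NewtonKernel`, `BiotSavartNewtonKernel`); `differentiableOn_integral_of_dominated`
(`Complex/HolomorphicParametricIntegral.lean`). Mathlib: `Complex.norm_cpow_real`,
`Complex.ofReal_cpow`, `DifferentiableAt.cpow_const` (`slitPlane`), `Real.rpow_le_rpow_of_nonpos`,
`EuclideanSpace.basisFun`, `ContinuousLinearMap.integral_comp_comm`.

## References

* Z. Bradshaw, Z. Grujić, I. Kukavica, *Local analyticity radii of solutions to the 3D
  Navier–Stokes equations with locally analytic forcing*, J. Differential Equations 259 (2015),
  Thm. 2.3 and §4. [BradshawGrujicKukavica2015JDE]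
* Z. Bradshaw, Z. Grujić, I. Kukavica, in: *Recent progress in the theory of the Euler and
  Navier–Stokes equations*, LMS Lecture Note Ser. 430, CUP 2016, Thm. 2.3.1.
  [BradshawGrujicKukavica2016]
* D. Gilbarg, N. S. Trudinger, *Elliptic Partial Differential Equations of Second Order* (2001),
  (4.9) and Lemma 4.1 (the gradient of the Newtonian potential). [GilbargTrudinger2001]
-/

noncomputable section

open MeasureTheory Set Filter Metric Real
open _root_.Topology
open _root_.Complex (I)
open scoped BigOperators

namespace Literature.Analysis.FluidPDE

open Literature.Analysis.FunctionSpaces (EuclideanSpace.complexify)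
open Literature.Analysis.FunctionSpaces.EuclideanSpace (complexify complexify_apply norm_complexify)

/-! ### The complexified gradient kernel -/

/-- **The complexified gradient of the Newtonian kernel**,
`∇Γ_ℂ(ξ) = ξ / (4π (ξ·ξ)^{3/2})` (principal power of the bilinear square `ξ·ξ = cdot ξ ξ`): the
holomorphic continuation, to `Re(ξ·ξ) > 0`, of `∇Γ(z) = z/(4π|z|³)`, `Γ(z) = -1/(4π|z|)`
(Gilbarg–Trudinger (4.9)). [folklore] -/
def newtonGradKernelC (ξ : EuclideanSpace ℂ (Fin 3)) : EuclideanSpace ℂ (Fin 3) :=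
  ((((4 * π)⁻¹ : ℝ) : ℂ) * cdot ξ ξ ^ (((-(3 / 2) : ℝ)) : ℂ)) • ξ

/-- Unfolding lemma. [folklore] -/
theorem newtonGradKernelC_def (ξ : EuclideanSpace ℂ (Fin 3)) :
    newtonGradKernelC ξ = ((((4 * π)⁻¹ : ℝ) : ℂ) * cdot ξ ξ ^ (((-(3 / 2) : ℝ)) : ℂ)) • ξ :=
  rfl

/-- **Real restriction of the complexified gradient kernel**:
`∇Γ_ℂ(cx z) = cx ((4π‖z‖³)⁻¹ z)` for every real `z` (both sides vanish at `z = 0`). [folklore] -/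
theorem newtonGradKernelC_complexify (z : EuclideanSpace ℝ (Fin 3)) :
    newtonGradKernelC (complexify z) = complexify ((4 * π * ‖z‖ ^ 3)⁻¹ • z) := by
  rw [newtonGradKernelC_def, cdot_complexify_self, ← Complex.ofReal_cpow (sq_nonneg _),
    ← Complex.ofReal_mul, complexify_smul]
  congr 2
  have h3 : (‖z‖ ^ 2) ^ ((-(3 / 2) : ℝ)) = (‖z‖ ^ 3)⁻¹ := by
    rw [← Real.rpow_natCast ‖z‖ 2, ← Real.rpow_mul (norm_nonneg z), ← Real.rpow_natCast ‖z‖ 3,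
      ← Real.rpow_neg (norm_nonneg z)]
    norm_num
  rw [h3]
  ring

/-- Coordinates of the real restriction: `(∇Γ_ℂ(cx z))ⱼ = ∂ⱼΓ(z) = DΓ(z) eⱼ` for every `z`
(at `z = 0` both are the junk value `0`). [folklore] -/
theorem newtonGradKernelC_complexify_apply (z : EuclideanSpace ℝ (Fin 3)) (j : Fin 3) :
    newtonGradKernelC (complexify z) j =
      ((fderiv ℝ newtonKernel z (EuclideanSpace.single j (1 : ℝ)) : ℝ) : ℂ) := by
  rw [newtonGradKernelC_complexify, complexify_apply, PiLp.smul_apply, smul_eq_mul]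
  by_cases hz : z = 0
  · subst hz
    simp [fderiv_newtonKernel_zero]
  · rw [fderiv_newtonKernel_apply hz, EuclideanSpace.inner_single_right]
    simp [div_eq_inv_mul]

/-- **The real restriction as a frame sum**: `∇Γ_ℂ(cx z) = ∑ⱼ ∂ⱼΓ(z) • cx eⱼ`. [folklore] -/
theorem newtonGradKernelC_complexify_eq_sum (z : EuclideanSpace ℝ (Fin 3)) :
    newtonGradKernelC (complexify z) =
      ∑ j, ((fderiv ℝ newtonKernel z (EuclideanSpace.single j (1 : ℝ)) : ℝ) : ℂ) •
        complexify (EuclideanSpace.single j (1 : ℝ)) := by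
  have h : ∀ v : EuclideanSpace ℂ (Fin 3),
      v = ∑ j, v j • complexify (EuclideanSpace.single j (1 : ℝ)) := by
    intro v
    have hb := (EuclideanSpace.basisFun (Fin 3) ℂ).sum_repr v
    have hc : ∀ j : Fin 3, complexify (EuclideanSpace.single j (1 : ℝ)) =
        EuclideanSpace.single j (1 : ℂ) := by
      intro j
      ext i
      by_cases hij : i = j
      · subst hij; simp [complexify_apply]
      · simp [complexify_apply, hij]
    simp_rw [hc]
    conv_lhs => rw [← hb]
    simp [EuclideanSpace.basisFun_apply, EuclideanSpace.basisFun_repr]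
  conv_lhs => rw [h (newtonGradKernelC (complexify z))]
  simp_rw [newtonGradKernelC_complexify_apply]

/-- **Holomorphy of the complexified gradient kernel** (composable form): if `f` is complex
differentiable at `p` and `Re (f p · f p) > 0`, then `p ↦ ∇Γ_ℂ(f p)` is complex differentiable
at `p` (the principal power is holomorphic on the slit plane). [folklore] -/
theorem _root_.DifferentiableAt.newtonGradKernelC {P : Type*} [NormedAddCommGroup P]
    [NormedSpace ℂ P] {f : P → EuclideanSpace ℂ (Fin 3)} {p : P}
    (hf : DifferentiableAt ℂ f p) (h : 0 < (cdot (f p) (f p)).re) :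
    DifferentiableAt ℂ (fun q => newtonGradKernelC (f q)) p := by
  simp only [newtonGradKernelC_def]
  have hs : cdot (f p) (f p) ∈ Complex.slitPlane := Complex.mem_slitPlane_iff.2 (Or.inl h)
  exact ((differentiableAt_const _).mul ((hf.cdot hf).cpow_const hs)).smul hf

/-! ### The sector `‖η‖ ≤ ‖r‖/2` -/

/-- `Re ((cx r + i cx η)·(cx r + i cx η)) = ‖r‖² - ‖η‖²`. [folklore] -/
theorem re_cdot_complexify_add_I_smul (r η : EuclideanSpace ℝ (Fin 3)) :
    (cdot (complexify r + I • complexify η) (complexify r + I • complexify η)).re =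
      ‖r‖ ^ 2 - ‖η‖ ^ 2 := by
  have e : cdot (complexify r + I • complexify η) (complexify r + I • complexify η) =
      ((‖r‖ ^ 2 - ‖η‖ ^ 2 : ℝ) : ℂ) + ((2 * inner ℝ r η : ℝ) : ℂ) * I := by
    rw [cdot_add_left, cdot_add_right, cdot_add_right]
    simp only [cdot_smul_left, cdot_smul_right, cdot_complexify_self, cdot_complexify,
      real_inner_comm r η]
    push_cast
    linear_combination ((‖η‖ : ℂ) ^ 2) * Complex.I_sq
  rw [e, Complex.add_re, Complex.ofReal_re, Complex.re_ofReal_mul, Complex.I_re, mul_zero,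
    add_zero]

/-- In the sector, `Re (ξ·ξ) ≥ 3‖r‖²/4 > 0` for `r ≠ 0`. [folklore] -/
theorem re_cdot_complexify_add_I_smul_ge {r η : EuclideanSpace ℝ (Fin 3)} (hη : ‖η‖ ≤ ‖r‖ / 2) :
    3 / 4 * ‖r‖ ^ 2 ≤
      (cdot (complexify r + I • complexify η) (complexify r + I • complexify η)).re := by
  rw [re_cdot_complexify_add_I_smul]
  nlinarith [norm_nonneg η, norm_nonneg r]

/-- In the sector and off `r = 0` the bilinear square has positive real part. [folklore] -/
theorem re_cdot_complexify_add_I_smul_pos {r η : EuclideanSpace ℝ (Fin 3)} (hr : r ≠ 0)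
    (hη : ‖η‖ ≤ ‖r‖ / 2) :
    0 < (cdot (complexify r + I • complexify η) (complexify r + I • complexify η)).re := by
  have h := re_cdot_complexify_add_I_smul_ge hη
  have hr' : 0 < ‖r‖ := norm_pos_iff.2 hr
  nlinarith

/-- **The sector bound of the complexified gradient kernel**:
`‖∇Γ_ℂ(cx r + i cx η)‖ ≤ ‖r‖⁻²` for `‖η‖ ≤ ‖r‖/2` (there `|ξ·ξ| ≥ 3‖r‖²/4`, `‖ξ‖ ≤ 3‖r‖/2`,
and `(3/2)(4/3)^{3/2}/(4π) < 1`). [folklore] -/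
theorem norm_newtonGradKernelC_le {r η : EuclideanSpace ℝ (Fin 3)} (hη : ‖η‖ ≤ ‖r‖ / 2) :
    ‖newtonGradKernelC (complexify r + I • complexify η)‖ ≤ (‖r‖ ^ 2)⁻¹ := by
  by_cases hr : r = 0
  · subst hr
    have hη0 : η = 0 := by
      have : ‖η‖ ≤ 0 := by simpa using hη
      exact norm_eq_zero.1 (le_antisymm this (norm_nonneg _))
    subst hη0
    simp [newtonGradKernelC_def]
  set ξ : EuclideanSpace ℂ (Fin 3) := complexify r + I • complexify η with hξ
  have hr' : 0 < ‖r‖ := norm_pos_iff.2 hr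
  have hre : 3 / 4 * ‖r‖ ^ 2 ≤ (cdot ξ ξ).re := re_cdot_complexify_add_I_smul_ge hη
  have hm : 3 / 4 * ‖r‖ ^ 2 ≤ ‖cdot ξ ξ‖ := hre.trans (Complex.re_le_norm _)
  have hm0 : 0 < ‖cdot ξ ξ‖ := lt_of_lt_of_le (by positivity) hm
  -- the power
  have hpow : ‖cdot ξ ξ ^ (((-(3 / 2) : ℝ)) : ℂ)‖ = (‖cdot ξ ξ‖ ^ ((3 / 2 : ℝ)))⁻¹ := by
    rw [Complex.norm_cpow_real, Real.rpow_neg (norm_nonneg _)]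
  have hsqrt : 5 / 6 * ‖r‖ ≤ Real.sqrt ‖cdot ξ ξ‖ := by
    refine Real.le_sqrt_of_sq_le ?_
    nlinarith
  have h32 : ‖cdot ξ ξ‖ ^ ((3 / 2 : ℝ)) = ‖cdot ξ ξ‖ * Real.sqrt ‖cdot ξ ξ‖ := by
    rw [show ((3 / 2 : ℝ)) = 1 + 1 / 2 by norm_num, Real.rpow_add hm0, Real.rpow_one,
      Real.sqrt_eq_rpow]
  have hlow : 5 / 8 * ‖r‖ ^ 3 ≤ ‖cdot ξ ξ‖ ^ ((3 / 2 : ℝ)) := by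
    rw [h32]
    calc 5 / 8 * ‖r‖ ^ 3 = (3 / 4 * ‖r‖ ^ 2) * (5 / 6 * ‖r‖) := by ring
      _ ≤ ‖cdot ξ ξ‖ * Real.sqrt ‖cdot ξ ξ‖ :=
          mul_le_mul hm hsqrt (by positivity) (norm_nonneg _)
  have hξn : ‖ξ‖ ≤ 3 / 2 * ‖r‖ := by
    calc ‖ξ‖ ≤ ‖complexify r‖ + ‖I • complexify η‖ := norm_add_le _ _
      _ = ‖r‖ + ‖η‖ := by rw [norm_complexify, norm_smul, Complex.norm_I, one_mul, norm_complexify]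
      _ ≤ 3 / 2 * ‖r‖ := by linarith
  have hpi : (4 * π)⁻¹ ≤ (12 : ℝ)⁻¹ := by
    refine inv_anti₀ (by norm_num) ?_
    linarith [Real.pi_gt_three]
  rw [newtonGradKernelC_def, norm_smul, norm_mul, Complex.norm_real, Real.norm_eq_abs,
    abs_of_pos (by positivity : (0 : ℝ) < (4 * π)⁻¹), hpow]
  have hA : 0 < ‖cdot ξ ξ‖ ^ ((3 / 2 : ℝ)) := by positivity
  calc (4 * π)⁻¹ * (‖cdot ξ ξ‖ ^ ((3 / 2 : ℝ)))⁻¹ * ‖ξ‖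
      ≤ (12 : ℝ)⁻¹ * (5 / 8 * ‖r‖ ^ 3)⁻¹ * (3 / 2 * ‖r‖) := by
        gcongr
  _ = (5 : ℝ)⁻¹ * (‖r‖ ^ 2)⁻¹ := by
        field_simp
        ring
  _ ≤ (‖r‖ ^ 2)⁻¹ := by
        have : 0 < (‖r‖ ^ 2)⁻¹ := by positivity
        nlinarith

/-! ### The continued gradient potential -/

/-- **The continued gradient potential** of a real density `g`:
`newtonGradPotentialC g ζ = ∫ g(w) ∇Γ_ℂ(ζ - cx w) dw` — at real points the gradient potential
`∇(Γ ⋆ g)(x) = ∫ ∇Γ(x - w) g(w) dw` (Gilbarg–Trudinger Lemma 4.1), at complex points `ζ` over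
the complement of the support of `g` its holomorphic continuation. [folklore] -/
def newtonGradPotentialC (g : EuclideanSpace ℝ (Fin 3) → ℝ) (ζ : EuclideanSpace ℂ (Fin 3)) :
    EuclideanSpace ℂ (Fin 3) :=
  ∫ w, (g w : ℂ) • newtonGradKernelC (ζ - complexify w)

/-- Unfolding lemma. [folklore] -/
theorem newtonGradPotentialC_def (g : EuclideanSpace ℝ (Fin 3) → ℝ) (ζ : EuclideanSpace ℂ (Fin 3)) :
    newtonGradPotentialC g ζ = ∫ w, (g w : ℂ) • newtonGradKernelC (ζ - complexify w) :=
  rfl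

/-- `cx x + i cx y - cx w = cx (x - w) + i cx y` (the lemma
`complexify_add_I_smul_sub_complexify` of `NSAnalyticityRadiusLinftyProofs.lean`, not imported
here). [folklore] -/
theorem cx_add_I_smul_cx_sub_cx (x y w : EuclideanSpace ℝ (Fin 3)) :
    complexify x + I • complexify y - complexify w = complexify (x - w) + I • complexify y := by
  rw [map_sub]
  abel

/-- **Off-support kernel bound**: for `‖y‖ ≤ D/2` and `‖x - w‖ ≥ D > 0`,
`‖∇Γ_ℂ(cx x + i cx y - cx w)‖ ≤ D⁻²`. [folklore] -/
theorem norm_newtonGradKernelC_sub_le {x y w : EuclideanSpace ℝ (Fin 3)} {D : ℝ} (hD : 0 < D)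
    (hy : ‖y‖ ≤ D / 2) (hw : D ≤ ‖x - w‖) :
    ‖newtonGradKernelC (complexify x + I • complexify y - complexify w)‖ ≤ (D ^ 2)⁻¹ := by
  rw [cx_add_I_smul_cx_sub_cx]
  refine (norm_newtonGradKernelC_le (by linarith)).trans ?_
  exact inv_anti₀ (by positivity) (pow_le_pow_left₀ hD.le hw 2)

/-- **Off-support holomorphy of the kernel**: for `‖y‖ ≤ D/2` and `‖x - w‖ ≥ D > 0`,
`ζ ↦ ∇Γ_ℂ(ζ - cx w)` is complex differentiable at `cx x + i cx y`. [folklore] -/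
theorem differentiableAt_newtonGradKernelC_sub {x y w : EuclideanSpace ℝ (Fin 3)} {D : ℝ}
    (hD : 0 < D) (hy : ‖y‖ ≤ D / 2) (hw : D ≤ ‖x - w‖) :
    DifferentiableAt ℂ (fun ζ => newtonGradKernelC (ζ - complexify w))
      (complexify x + I • complexify y) := by
  have hne : x - w ≠ 0 := by
    intro h0
    rw [h0, norm_zero] at hw
    linarith
  refine (differentiableAt_id.sub_const (complexify w)).newtonGradKernelC ?_
  rw [id, cx_add_I_smul_cx_sub_cx]
  exact re_cdot_complexify_add_I_smul_pos hne (by linarith)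

/-- Pointwise bound of the integrand of the continued potential at an admissible point:
`‖g(w) ∇Γ_ℂ(cx x + i cx y - cx w)‖ ≤ D⁻² |g(w)|` when `‖y‖ ≤ D/2` and `dist(x, supp g) ≥ D`.
[folklore] -/
theorem norm_smul_newtonGradKernelC_sub_le {g : EuclideanSpace ℝ (Fin 3) → ℝ}
    {x y : EuclideanSpace ℝ (Fin 3)} {D : ℝ} (hD : 0 < D) (hy : ‖y‖ ≤ D / 2)
    (hs : ∀ w ∈ tsupport g, D ≤ ‖x - w‖) (w : EuclideanSpace ℝ (Fin 3)) :
    ‖(g w : ℂ) • newtonGradKernelC (complexify x + I • complexify y - complexify w)‖ ≤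
      (D ^ 2)⁻¹ * |g w| := by
  by_cases hw : g w = 0
  · simp [hw]
  · have hws : w ∈ tsupport g := subset_tsupport _ (Function.mem_support.2 hw)
    rw [norm_smul, Complex.norm_real, Real.norm_eq_abs, mul_comm]
    exact mul_le_mul_of_nonneg_right (norm_newtonGradKernelC_sub_le hD hy (hs w hws))
      (abs_nonneg _)

/-- Continuity of the integrand of the continued potential in the integration variable, at an
admissible point (the kernel is continuous near the support of `g`, and `g` vanishes near every
other point). [folklore] -/
theorem continuous_smul_newtonGradKernelC_sub {g : EuclideanSpace ℝ (Fin 3) → ℝ}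
    (hg : Continuous g) {x y : EuclideanSpace ℝ (Fin 3)} {D : ℝ} (hD : 0 < D)
    (hy : ‖y‖ ≤ D / 2) (hs : ∀ w ∈ tsupport g, D ≤ ‖x - w‖) :
    Continuous fun w =>
      (g w : ℂ) • newtonGradKernelC (complexify x + I • complexify y - complexify w) := by
  refine continuous_iff_continuousAt.2 fun w₀ => ?_
  by_cases hw₀ : w₀ ∈ tsupport g
  · have hD' : D ≤ ‖x - w₀‖ := hs w₀ hw₀
    have hd : DifferentiableAt ℂ newtonGradKernelC
        (complexify x + I • complexify y - complexify w₀) := by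
      have hne : x - w₀ ≠ 0 := by
        intro h0
        rw [h0, norm_zero] at hD'
        linarith
      have h := (differentiableAt_id (𝕜 := ℂ)
        (x := complexify x + I • complexify y - complexify w₀)).newtonGradKernelC (by
          rw [id, cx_add_I_smul_cx_sub_cx]
          exact re_cdot_complexify_add_I_smul_pos hne (by linarith))
      exact h
    have h2 : ContinuousAt
        (fun w : EuclideanSpace ℝ (Fin 3) => complexify x + I • complexify y - complexify w)
        w₀ :=
      (continuous_const.sub
        Literature.Analysis.FunctionSpaces.EuclideanSpace.continuous_complexify).continuousAt
    have hk : ContinuousAt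
        (fun w => newtonGradKernelC (complexify x + I • complexify y - complexify w)) w₀ :=
      ContinuousAt.comp
        (f := fun w : EuclideanSpace ℝ (Fin 3) =>
          complexify x + I • complexify y - complexify w)
        hd.continuousAt h2
    exact ((Complex.continuous_ofReal.comp hg).continuousAt).smul hk
  · have hev : (fun w => (g w : ℂ) •
        newtonGradKernelC (complexify x + I • complexify y - complexify w)) =ᶠ[𝓝 w₀]
        fun _ => 0 := by
      filter_upwards [notMem_tsupport_iff_eventuallyEq.1 hw₀] with w hw
      simp [hw]
    exact (continuousAt_const).congr_of_eventuallyEq hev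

/-- **Holomorphy of the continued gradient potential off the support of the density.** Let `g`
be continuous with compact support, `D > 0`, and let `V ⊆ ℂ³` be an open set all of whose
points are `cx x + i cx y` with `‖y‖ ≤ D/2` and `‖x - w‖ ≥ D` for every `w ∈ supp g`. Then
`newtonGradPotentialC g` is holomorphic on `V` (holomorphy of dominated parameter integrals: the
integrand is holomorphic in `ζ` and dominated by the integrable `D⁻²|g|`). [folklore] -/
theorem differentiableOn_newtonGradPotentialC {g : EuclideanSpace ℝ (Fin 3) → ℝ}
    (hg : Continuous g) (hgc : HasCompactSupport g) {D : ℝ} (hD : 0 < D)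
    {V : Set (EuclideanSpace ℂ (Fin 3))} (hV : IsOpen V)
    (hadm : ∀ ζ ∈ V, ∃ x y : EuclideanSpace ℝ (Fin 3),
      ζ = complexify x + I • complexify y ∧ ‖y‖ ≤ D / 2 ∧ ∀ w ∈ tsupport g, D ≤ ‖x - w‖) :
    DifferentiableOn ℂ (newtonGradPotentialC g) V := by
  show DifferentiableOn ℂ
    (fun ζ => ∫ w, (g w : ℂ) • newtonGradKernelC (ζ - complexify w)) V
  refine Literature.Analysis.Complex.differentiableOn_integral_of_dominated
    (F := fun ζ w => (g w : ℂ) • newtonGradKernelC (ζ - complexify w)) ?_ ?_ ?_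
  · intro ζ hζ
    obtain ⟨x, y, rfl, hy, hs⟩ := hadm ζ hζ
    exact (continuous_smul_newtonGradKernelC_sub hg hD hy hs).aestronglyMeasurable
  · refine Eventually.of_forall fun w => ?_
    intro ζ hζ
    by_cases hw : g w = 0
    · simp only [hw, Complex.ofReal_zero, zero_smul]
      exact differentiableWithinAt_const _
    · obtain ⟨x, y, rfl, hy, hs⟩ := hadm ζ hζ
      have hws : w ∈ tsupport g := subset_tsupport _ (Function.mem_support.2 hw)
      exact ((differentiableAt_newtonGradKernelC_sub hD hy (hs w hws)).const_smul
        (g w : ℂ)).differentiableWithinAt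
  · intro ζ₀ hζ₀
    obtain ⟨R, hR, hball⟩ := Metric.isOpen_iff.1 hV ζ₀ hζ₀
    refine ⟨R, hR, hball, fun w => (D ^ 2)⁻¹ * |g w|,
      ((hg.integrable_of_hasCompactSupport hgc).abs.const_mul _),
      Eventually.of_forall fun w ζ hζ => ?_⟩
    obtain ⟨x, y, rfl, hy, hs⟩ := hadm ζ (hball hζ)
    exact norm_smul_newtonGradKernelC_sub_le hD hy hs w

/-- **Bound of the continued gradient potential**: at an admissible point,
`‖newtonGradPotentialC g (cx x + i cx y)‖ ≤ D⁻² ‖g‖_{L¹}`. [folklore] -/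
theorem norm_newtonGradPotentialC_le {g : EuclideanSpace ℝ (Fin 3) → ℝ} (hg : Continuous g)
    (hgc : HasCompactSupport g) {D : ℝ} (hD : 0 < D) {x y : EuclideanSpace ℝ (Fin 3)}
    (hy : ‖y‖ ≤ D / 2) (hs : ∀ w ∈ tsupport g, D ≤ ‖x - w‖) :
    ‖newtonGradPotentialC g (complexify x + I • complexify y)‖ ≤ (D ^ 2)⁻¹ * ∫ w, |g w| := by
  rw [newtonGradPotentialC_def, ← integral_const_mul]
  exact norm_integral_le_of_norm_le ((hg.integrable_of_hasCompactSupport hgc).abs.const_mul _)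
    (Eventually.of_forall (norm_smul_newtonGradKernelC_sub_le hD hy hs))

/-- **The continued potential restricts to the gradient potential on real points**: for
continuous compactly supported `g` and every real `x`,
`newtonGradPotentialC g (cx x) = cx (∑ⱼ T_{eⱼ} g (x) eⱼ)`, `T_a g (x) = ∫ ∂_aΓ(x - w) g(w) dw`
(`newtonGradPotential`). [folklore] -/
theorem newtonGradPotentialC_complexify {g : EuclideanSpace ℝ (Fin 3) → ℝ} (hg : Continuous g)
    (hgc : HasCompactSupport g) (x : EuclideanSpace ℝ (Fin 3)) :
    newtonGradPotentialC g (complexify x) =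
      complexify (∑ j, newtonGradPotential (EuclideanSpace.single j (1 : ℝ)) g x •
        EuclideanSpace.single j (1 : ℝ)) := by
  have hI : ∀ j : Fin 3, Integrable fun w =>
      fderiv ℝ newtonKernel (x - w) (EuclideanSpace.single j (1 : ℝ)) • g w := fun j =>
    integrable_fderiv_newtonKernel_smul hg hgc x _
  have hpt : ∀ w, (g w : ℂ) • newtonGradKernelC (complexify x - complexify w) =
      ∑ j, (((fderiv ℝ newtonKernel (x - w) (EuclideanSpace.single j (1 : ℝ)) • g w : ℝ)) : ℂ) •
        complexify (EuclideanSpace.single j (1 : ℝ)) := by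
    intro w
    rw [← map_sub, newtonGradKernelC_complexify_eq_sum, Finset.smul_sum]
    refine Finset.sum_congr rfl fun j _ => ?_
    rw [smul_smul, smul_eq_mul, Complex.ofReal_mul, mul_comm]
  rw [newtonGradPotentialC_def]
  simp_rw [hpt]
  have hsum := integral_finsetSum Finset.univ (μ := (volume : Measure (EuclideanSpace ℝ (Fin 3))))
    fun j (_ : j ∈ Finset.univ) =>
      ((hI j).ofReal (𝕜 := ℂ)).smul_const (complexify (EuclideanSpace.single j (1 : ℝ)))
  rw [map_sum]
  refine hsum.trans (Finset.sum_congr rfl fun j _ => ?_)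
  rw [integral_smul_const, integral_ofReal, complexify_smul, newtonGradPotential]
  rfl

/-- Coordinates of the real restriction: `(newtonGradPotentialC g (cx x))ⱼ = T_{eⱼ} g (x)`.
[folklore] -/
theorem newtonGradPotentialC_complexify_apply {g : EuclideanSpace ℝ (Fin 3) → ℝ}
    (hg : Continuous g) (hgc : HasCompactSupport g) (x : EuclideanSpace ℝ (Fin 3)) (j : Fin 3) :
    newtonGradPotentialC g (complexify x) j =
      ((newtonGradPotential (EuclideanSpace.single j (1 : ℝ)) g x : ℝ) : ℂ) := by
  rw [newtonGradPotentialC_complexify hg hgc x, complexify_apply]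
  congr 1
  simp [Finset.sum_apply, Pi.single_apply]

/-! ### The geometry of the local complex region over a ball -/

/-- **Admissibility of the local complex region**: if `supp g` keeps distance `ρ + D` from
`x₀` and `h ≤ D/2`, every point of `localComplexTube x₀ ρ h` is `cx x + i cx y` with
`‖y‖ ≤ D/2` and `‖x - w‖ ≥ D` on `supp g`. [folklore] -/
theorem localComplexTube_admissible {g : EuclideanSpace ℝ (Fin 3) → ℝ}
    {x₀ : EuclideanSpace ℝ (Fin 3)} {ρ h D : ℝ} (hh : h ≤ D / 2)
    (hs : ∀ w ∈ tsupport g, ρ + D ≤ dist w x₀) {ζ : EuclideanSpace ℂ (Fin 3)}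
    (hζ : ζ ∈ localComplexTube x₀ ρ h) :
    ∃ x y : EuclideanSpace ℝ (Fin 3), ζ = complexify x + I • complexify y ∧ ‖y‖ ≤ D / 2 ∧
      ∀ w ∈ tsupport g, D ≤ ‖x - w‖ := by
  obtain ⟨x, y, hx, hy, rfl⟩ := mem_localComplexTube_iff.1 hζ
  refine ⟨x, y, rfl, by linarith, fun w hw => ?_⟩
  have h1 := hs w hw
  have h2 : dist w x₀ ≤ dist w x + dist x x₀ := dist_triangle _ _ _
  rw [← dist_eq_norm, dist_comm]
  linarith

/-- **Holomorphy on the local complex region**: under the geometry of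
`localComplexTube_admissible` (and `D > 0`), `newtonGradPotentialC g` is holomorphic on
`localComplexTube x₀ ρ h`. [folklore] -/
theorem differentiableOn_newtonGradPotentialC_localComplexTube
    {g : EuclideanSpace ℝ (Fin 3) → ℝ} (hg : Continuous g) (hgc : HasCompactSupport g)
    {x₀ : EuclideanSpace ℝ (Fin 3)} {ρ h D : ℝ} (hD : 0 < D) (hh : h ≤ D / 2)
    (hs : ∀ w ∈ tsupport g, ρ + D ≤ dist w x₀) :
    DifferentiableOn ℂ (newtonGradPotentialC g) (localComplexTube x₀ ρ h) :=
  differentiableOn_newtonGradPotentialC hg hgc hD (isOpen_localComplexTube x₀ ρ h)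
    fun _ hζ => localComplexTube_admissible hh hs hζ

/-- **Bound on the local complex region**: under the same geometry,
`‖newtonGradPotentialC g ζ‖ ≤ D⁻² ‖g‖_{L¹}` on `localComplexTube x₀ ρ h`. [folklore] -/
theorem norm_newtonGradPotentialC_le_of_mem_localComplexTube
    {g : EuclideanSpace ℝ (Fin 3) → ℝ} (hg : Continuous g) (hgc : HasCompactSupport g)
    {x₀ : EuclideanSpace ℝ (Fin 3)} {ρ h D : ℝ} (hD : 0 < D) (hh : h ≤ D / 2)
    (hs : ∀ w ∈ tsupport g, ρ + D ≤ dist w x₀) {ζ : EuclideanSpace ℂ (Fin 3)}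
    (hζ : ζ ∈ localComplexTube x₀ ρ h) :
    ‖newtonGradPotentialC g ζ‖ ≤ (D ^ 2)⁻¹ * ∫ w, |g w| := by
  obtain ⟨x, y, rfl, hy, hs'⟩ := localComplexTube_admissible hh hs hζ
  exact norm_newtonGradPotentialC_le hg hgc hD hy hs'

end Literature.Analysis.FluidPDE
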